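import Summits.QuantumFields.YangMills.Theorems.BalabanUVNodesN15FullPropagatorExactSiteSocket
import Summits.QuantumFields.YangMills.Theorems.BalabanUVNodesN15VectorPieceBackground

/-!
# Route «BalabanUVNodes», cluster K4 «SpineRates» — node N15 = NE2: THE SITE LAYER WITH THE BACKGROUND LIVE IN THE TwoGrid ENTRY CURRENCY, IV — THE SITE SOCKET OVER AN
# ARBITRARY REALISED COARSE CARRIER `opGeo (unitTorusGeoS L k M M_sz) X blk` (any argument carrier `X`, any blocks, the [B9] size datum `M_sz` LIVE): scalar-carrier families
# (dag-n15-e's King-model rung `bgKingInstance`, dag-n15-b's `bgInstance`) and sized vector families plug in, not only part II's `tgGeoC` (vector carrier, `M ≡ 1`)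

Cell `pub-ymgap`, WIDTH SEAT `pub-ymgap-dag-n15-w1` (generation 0; director-ym №197 ∕ HUMAN RULING D-0149; chair R455 (A) ∕ R461; plan g77 `W-SEAT-START-LIST.md` §2 n15 ITEM 1 —
bus CLAIM pub-ymgap INBOX l.24149).  `bears_on: R4∕N15 · K3⁷ SpineGivenEndpointR13SepCoPH (stmt-QuantumFields-20544)`.  Filed `--kind definition --supports stmt-QuantumFields-20544
--as helper` — COUNT-NEUTRAL.  One data `def` (the site kernel `sSiteExOn`), the rest theorems; 0 `sorry`.  Imports this seat's part II `…N15FullPropagatorExactSiteSocket` (`siteEx`,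
`siteEx_zero`; part I's engine `abs_inv_add_sub_inv_add_le_of_coercive` and letter block `siteForm_letters_family`; G1's `etaRateIneqSite_opGeo_unit` through it) and dag-n15-a part 27
`…N15VectorPieceBackground` (`unitTorusGeoS`); nothing in the tree is modified.

WHY.  Part II typed the socket on dag-n15-a's `tgGeoC d hL (ι i) = opGeo (unitTorusGeo L k M) (Tor (fine L^k M) × Fin (d+1)) blkFine` — the VECTOR argument carrier with the [B9]
size parameter INERT (`M ≡ 1`; ref-B READ-686 ∕ dag-n15-a l.≈24335: on such families `NE2PlusSite`'s STATEMENT also has the trivial proof `M₅ := 2`).  The families on which the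
site conjunct is NON-vacuous as a statement are the SIZED ones — `unitTorusGeoS L k M M_sz` with `M_sz` ranging (dag-n15-a part 25∕27, dag-n15-c's `VecIndexS`, dag-n15-e's
`KingBgIdx` with `bgKingInstance_gf_M`) — and the King-model rung's carriers are SCALAR (`X = Tor (fine N M)`, blocks `blockOf`).  Nothing in part II's proof used the argument
carrier or the size field: the site kernel lives on the unit-torus SITES `Tor M` through `torIdx`, and G1's unit-site readout is generic over `opGeo g X blk` with `g.len ≡ 1`.  THIS
FILE re-types the socket over the general realised coarse carrier `opGeo (unitTorusGeoS L (k i) (M i) (M_sz i)) (X i) (blk i)` on the tori of record `M i = 2L^{m_T i}`, per-index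
scales `k i ≥ 1`, shifts `m i`: same letters, same constants, same proof.

CONTENTS.  def ★ `sSiteExOn`; `sSiteExOn_ker`; `sSiteExOn_of_zero` (both perturbations vanish ⟹ G1's genuine kernel `(Q′G′²Q′*)⁻¹_{fine} − (Q′G′²Q′*)⁻¹_{coarse}` at the sites);
★★★ **`ne2PlusSite_sSiteExOn_of_letters`** (guard scales `(gf i).M ≥ 1`, exponent `γ_P > 0`, the three site letters `hP` ⟹ `NE2PlusSite d′ p c₃₅ pi (sSiteExOn …)`, constants as in
part II); ★★ `n15At_s_of_layers` (an operator layer and a unit layer BY NAME on the same family + `hP` ⟹ `N15At`).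

HONEST FRAMING.  Count-neutral SOCKET (kernel bookkeeping + parts I∕II ∕ G1 ∕ b05 by name); `hP` (and `hop`, `hunit`) are HYPOTHESES; the zero perturbations inhabit `hP`
(part II `siteLetters_zero`'s pattern) and give back the `U ≡ 1` kernel; a U-seeing inhabitant = a site-perturbation species (LOCATED in part II's header; for the King-model rung:
`Q′(X(c′)² − A₀⁻²)Q′*` from dag-n15-e Σ-a's letters — that lane's call).  MODEL level where instantiated ([B5]'s scalar `Q′, G′` at King's couplings on the unit tori `2L^{m_T}`).
NOT [B9] Thm 3.2 at a general (3.35)-regular `U` (NE2⁺ NOT PRINTED as an η-rate); Node 00's [B9] layers of record are residual — **N15 is NOT discharged** (typed 28∕28 · discharged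
5∕27 of record unchanged); one finite four-torus programme at fixed `ε` — NOT ℝ⁴, NOT infinite volume, NOT OS, NOT a mass gap, NOT Clay; R4 closes the conditional finite-𝕋⁴ rung
`BalabanLadder.UV` only.  Restate-immune (no Theses import).
-/

set_option autoImplicit false

noncomputable section

open scoped BigOperators Matrix
open Finset

namespace Summit.QuantumFields.YangMills.BalabanUVNodes.N15.SiteLayerBg

open Literature.MathematicalPhysics.QuantumFieldTheory.Balaban1983to89
open Literature.MathematicalPhysics.QuantumFieldTheory.Balaban1983to89.QGQInverse (Coercive)
open Literature.MathematicalPhysics.QuantumFieldTheory.King1986 (exp_decay_mono aK aK_pos)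
open Literature.MathematicalPhysics.QuantumFieldTheory.King1986.Torus (tdistT)
open Literature.MathematicalPhysics.QuantumFieldTheory.Balaban1983to89.T4EtaRate (PairedInstance EtaPairing NE2PlusOperator NE2PlusSite NE2PlusUnit EtaRateIneqSite)
open Literature.MathematicalPhysics.QuantumFieldTheory.Balaban1983to89.T4EtaRateDefect (rateWeight)
open Literature.MathematicalPhysics.QuantumFieldTheory.Balaban1983to89.B5Prop11Plancherel (Tor fine)
open Literature.MathematicalPhysics.QuantumFieldTheory.Balaban1983to89.B4Sect5Torus (tdist tdist_nonneg tdist_symm tdist_triangle tdist_self torusSum_le)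
open Literature.MathematicalPhysics.QuantumFieldTheory.Balaban1983to89.B4Sect5Proof (latticeConst latticeConst_nonneg)
open Literature.MathematicalPhysics.QuantumFieldTheory.Balaban1983to89.B5QGGQ145Bounds (Idx kerRe qggqRe)
open Literature.MathematicalPhysics.QuantumFieldTheory.Balaban1983to89.B5PBridgeProjection (torIdx)
open Summit.QuantumFields.YangMills.BalabanUVNodes.N15.OperatorReadout (opGeo)
open Summit.QuantumFields.YangMills.BalabanUVNodes.N15.VectorPiece (unitTorusGeoS)
open Summit.QuantumFields.YangMills.BalabanUVNodes.N15.TwoGrid (tdistT_eq_tdist_torIdx)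
open Summit.QuantumFields.YangMills.BalabanUVNodes.N15.GenuineSite (etaRateIneqSite_opGeo_unit)
open YMDAG.UVSplit (N15At)

variable {d : ℕ} {L : ℕ} [NeZero L] {I : Type}
variable (Mn : I → Fin (d + 1) → ℕ) [hMn0 : ∀ i μ, NeZero (Mn i μ)] (kk mm : I → ℕ) (Msz : I → ℝ) (X : I → Type) [∀ i, Fintype (X i)] (blk : ∀ i, X i → Tor (Mn i))
  (gf : I → B9.Geometry) (Bc Bf : I → B9.Backgrounds)

/-! ## §1 The site socket kernel over an arbitrary realised coarse carrier -/

/-- ★ **THE SITE SOCKET KERNEL OVER A GENERAL REALISED COARSE CARRIER** `opGeo (unitTorusGeoS L (k i) (M i) (M_sz i)) (X i) (blk i)` (ANY argument carrier `X i`, ANY blocks, size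
datum `M_sz i` live): at index `i` (torus `M i`, coarse scale `k i`, shift `m i`) the η-difference `(Q′G′²Q′*_{L^mL^k, a_{k+m}} + Pf i U)⁻¹(y,y′) − (Q′G′²Q′*_{L^k, a_k} + Pc i (avg U))⁻¹(y,y′)`
of the perturbed genuine site kernels of the two runs (part II's `siteEx` at the sites through `torIdx`). [cite: Balaban1985BackgroundPropagators, Thm 3.2 (3.48) p.398 + (3.65)–(3.67)
p.403 (shape of the dressed site kernel); King1986, p.664 (identity pairing of sites)] -/
def sSiteExOn (aS : ℝ) (pair : ∀ i, EtaPairing (opGeo (unitTorusGeoS L (kk i) (Mn i) (Msz i)) (X i) (blk i)) (gf i) (Bc i) (Bf i))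
    (Pf : ∀ i, (Bf i).Cfg → Matrix (Idx (Mn i)) (Idx (Mn i)) ℝ) (Pc : ∀ i, (Bc i).Cfg → Matrix (Idx (Mn i)) (Idx (Mn i)) ℝ) (i : I) :
    B9.SiteKernel (opGeo (unitTorusGeoS L (kk i) (Mn i) (Msz i)) (X i) (blk i)) (Bf i) :=
  ⟨fun U y y' =>
    siteEx (L ^ mm i * L ^ kk i) (aK aS L (kk i + mm i)) (Mn i) (Pf i U) (torIdx (Mn i) y) (torIdx (Mn i) y')
      - siteEx (L ^ kk i) (aK aS L (kk i)) (Mn i) (Pc i ((pair i).avg U)) (torIdx (Mn i) y) (torIdx (Mn i) y')⟩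

/-- Unfolding of `sSiteExOn`. [folklore] -/
theorem sSiteExOn_ker (aS : ℝ) (pair : ∀ i, EtaPairing (opGeo (unitTorusGeoS L (kk i) (Mn i) (Msz i)) (X i) (blk i)) (gf i) (Bc i) (Bf i))
    (Pf : ∀ i, (Bf i).Cfg → Matrix (Idx (Mn i)) (Idx (Mn i)) ℝ) (Pc : ∀ i, (Bc i).Cfg → Matrix (Idx (Mn i)) (Idx (Mn i)) ℝ) (i : I) (U : (Bf i).Cfg) (y y' : Tor (Mn i)) :
    (sSiteExOn Mn kk mm Msz X blk gf Bc Bf aS pair Pf Pc i).ker U y y' =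
      siteEx (L ^ mm i * L ^ kk i) (aK aS L (kk i + mm i)) (Mn i) (Pf i U) (torIdx (Mn i) y) (torIdx (Mn i) y')
        - siteEx (L ^ kk i) (aK aS L (kk i)) (Mn i) (Pc i ((pair i).avg U)) (torIdx (Mn i) y) (torIdx (Mn i) y') := rfl

/-- **WHERE BOTH PERTURBATIONS VANISH THE KERNEL IS THE GENUINE `U ≡ 1` SITE KERNEL's η-DIFFERENCE** `(Q′G′²Q′*)⁻¹_{L^mL^k, a_{k+m}} − (Q′G′²Q′*)⁻¹_{L^k, a_k}` at the sites (dag-n15-c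
G1's object; part II `siteEx_zero`) — the socket deforms it. [cite: Balaban1984PropagatorsI, p.25, (1.45) p.26] -/
theorem sSiteExOn_of_zero (hL : 1 < L) {aS : ℝ} (haS : 0 < aS) (hk : ∀ i, 1 ≤ kk i)
    (pair : ∀ i, EtaPairing (opGeo (unitTorusGeoS L (kk i) (Mn i) (Msz i)) (X i) (blk i)) (gf i) (Bc i) (Bf i))
    (Pf : ∀ i, (Bf i).Cfg → Matrix (Idx (Mn i)) (Idx (Mn i)) ℝ) (Pc : ∀ i, (Bc i).Cfg → Matrix (Idx (Mn i)) (Idx (Mn i)) ℝ) (i : I) (U : (Bf i).Cfg)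
    (hf : Pf i U = 0) (hc : Pc i ((pair i).avg U) = 0) (y y' : Tor (Mn i)) :
    (sSiteExOn Mn kk mm Msz X blk gf Bc Bf aS pair Pf Pc i).ker U y y' =
      kerRe (L ^ mm i * L ^ kk i) (aK aS L (kk i + mm i)) (Mn i) (torIdx (Mn i) y) (torIdx (Mn i) y')
        - kerRe (L ^ kk i) (aK aS L (kk i)) (Mn i) (torIdx (Mn i) y) (torIdx (Mn i) y') := by
  have hL0 : 0 < L := by omega
  have hLr : (1 : ℝ) < L := by exact_mod_cast hL
  have hLk : 1 ≤ L ^ kk i := Nat.one_le_pow _ _ hL0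
  have hLmk : 1 ≤ L ^ mm i * L ^ kk i :=
    Nat.one_le_iff_ne_zero.mpr (Nat.mul_ne_zero (by have := Nat.one_le_pow (mm i) L hL0; omega) (by omega))
  have hM1 : ∀ μ, 1 ≤ Mn i μ := fun μ => Nat.one_le_iff_ne_zero.mpr (NeZero.ne _)
  rw [sSiteExOn_ker, hf, hc, siteEx_zero _ hLmk (aK_pos haS hLr (by have := hk i; omega)) _ hM1, siteEx_zero _ hLk (aK_pos haS hLr (hk i)) _ hM1]

/-! ## §2 ★★★ The socket over the general carrier -/

/-- ★★★ **THE SITE SOCKET OVER A GENERAL REALISED COARSE CARRIER — `NE2PlusSite` BY NAME FROM THE PERTURBATIONS' LETTERS ALONE.**  Odd `L ≥ 3`, `a_S > 0`, `c₃₅`, exponents `(d′, p)`;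
a family `pi i = ⟨opGeo (unitTorusGeoS L (k i) (M i) (M_sz i)) (X i) (blk i), gf i, Bc i, Bf i, pair i⟩` on the tori of record `M i = 2L^{m_T i}` with `k i ≥ 1`, guard scales
`(gf i).M ≥ 1`; `γ_P > 0`; site perturbations `Pf`, `Pc` with the THREE LETTERS of part II (`|Pc i (avg U)|, |Pf i U| ≤ ζα₀e^{−δ_P·tdist}`, `|Pf i U − Pc i (avg U)| ≤ τ(L^{k i})^{−γ_P}e^{−δ_P·tdist}`
under `Reg335 c₃₅ α₀ U`, `α₀ ≤ a₁`) ⟹ `NE2PlusSite d′ p c₃₅ pi (sSiteExOn …)`, constants `(1, κ₁∕2, min a₁ (γ₀∕(4ζV₁)), (4∕γ₀)(C_r + τ)(4∕γ₀)V₂², min ¼ γ_P)` exactly as in part II —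
part II's proof with the argument carrier, the blocks and the size datum ARBITRARY (they never entered). [cite: Balaban1985BackgroundPropagators, Thm 3.2 (3.48) p.398 + Thm 3.14
pp.426–427 (quantifier template), (3.65)–(3.67) p.403 (mechanism); Balaban1984PropagatorsI, (1.45) p.26; King1986, Prop. 3.8 (3.71) p.664, (4.40)–(4.41) pp.674–675; CombesThomas1973, §II] -/
theorem ne2PlusSite_sSiteExOn_of_letters (hLodd : Odd L) (hL2 : 2 ≤ L) {aS : ℝ} (haS : 0 < aS) (c35 : ℝ) (d' : ℕ) (p : ℝ)
    {mT : I → ℕ} (hMnT : ∀ i μ, Mn i μ = 2 * L ^ mT i) (hk : ∀ i, 1 ≤ kk i) (hM : ∀ i, 1 ≤ (gf i).M)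
    (pair : ∀ i, EtaPairing (opGeo (unitTorusGeoS L (kk i) (Mn i) (Msz i)) (X i) (blk i)) (gf i) (Bc i) (Bf i))
    (Pf : ∀ i, (Bf i).Cfg → Matrix (Idx (Mn i)) (Idx (Mn i)) ℝ) (Pc : ∀ i, (Bc i).Cfg → Matrix (Idx (Mn i)) (Idx (Mn i)) ℝ) {γP : ℝ} (hγP : 0 < γP)
    (hP : ∃ δP ζ τ a₁ : ℝ, 0 < δP ∧ 0 < ζ ∧ 0 < τ ∧ 0 < a₁ ∧
      ∀ (i : I) (α₀ : ℝ), 0 < α₀ → α₀ ≤ a₁ → ∀ U : (Bf i).Cfg, (Bf i).Reg335 c35 α₀ U →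
        (∀ p q : Idx (Mn i), |Pc i ((pair i).avg U) p q| ≤ ζ * α₀ * Real.exp (-(δP * tdist (Mn i) p q))) ∧
        (∀ p q : Idx (Mn i), |Pf i U p q| ≤ ζ * α₀ * Real.exp (-(δP * tdist (Mn i) p q))) ∧
        (∀ p q : Idx (Mn i), |Pf i U p q - Pc i ((pair i).avg U) p q| ≤ τ * ((L : ℝ) ^ kk i) ^ (-γP) * Real.exp (-(δP * tdist (Mn i) p q)))) :
    NE2PlusSite d' p c35 (fun i => (⟨opGeo (unitTorusGeoS L (kk i) (Mn i) (Msz i)) (X i) (blk i), gf i, Bc i, Bf i, pair i⟩ : PairedInstance))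
      (sSiteExOn Mn kk mm Msz X blk gf Bc Bf aS pair Pf Pc) := by
  obtain ⟨γ₀, c₀, δ, Cr, hγ₀, hc₀, hδ, hCr, HF⟩ := siteForm_letters_family (d := d) hLodd hL2 haS
  obtain ⟨δP, ζ, τ, a₁, hδP, hζ, hτ, ha₁, HP⟩ := hP
  have hL0 : 0 < L := by omega
  have hLr : (1 : ℝ) < L := by exact_mod_cast (show 1 < L by omega)
  have hLR : (1 : ℝ) ≤ L := hLr.le
  -- the common rate, King's torus sums, the Combes–Thomas rate, the threshold (as in part II)
  obtain ⟨κ, hκdef⟩ : ∃ κ : ℝ, κ = min δ δP := ⟨_, rfl⟩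
  have hκ : 0 < κ := hκdef ▸ lt_min hδ hδP
  have hκδ : κ ≤ δ := hκdef ▸ min_le_left _ _
  have hκP : κ ≤ δP := hκdef ▸ min_le_right _ _
  obtain ⟨V₁, hV₁def⟩ : ∃ V₁ : ℝ, V₁ = latticeConst (d + 1) (κ / 4) + 1 := ⟨_, rfl⟩
  have hV₁1 : 1 ≤ V₁ := by rw [hV₁def]; linarith [latticeConst_nonneg (d + 1) (show 0 ≤ κ / 4 by positivity)]
  have hV₁0 : 0 < V₁ := by linarith
  obtain ⟨κ₁, hκ₁def⟩ : ∃ κ₁ : ℝ, κ₁ = min (κ / 4) (γ₀ * κ / (8 * (c₀ + ζ * a₁) * V₁)) := ⟨_, rfl⟩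
  have hden : 0 < 8 * (c₀ + ζ * a₁) * V₁ := by positivity
  have hκ₁ : 0 < κ₁ := hκ₁def ▸ lt_min (by positivity) (div_pos (by positivity) hden)
  have hκ₁κ : κ₁ ≤ κ / 4 := hκ₁def ▸ min_le_left _ _
  have hκ₁s : 8 * (c₀ + ζ * a₁) * V₁ * κ₁ ≤ γ₀ * κ := by
    have h1 : κ₁ ≤ γ₀ * κ / (8 * (c₀ + ζ * a₁) * V₁) := hκ₁def ▸ min_le_right _ _
    have h2 := mul_le_mul_of_nonneg_left h1 hden.le
    rwa [mul_div_cancel₀ _ hden.ne'] at h2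
  obtain ⟨V₂, hV₂def⟩ : ∃ V₂ : ℝ, V₂ = latticeConst (d + 1) (κ₁ / 2) + 1 := ⟨_, rfl⟩
  have hV₂0 : 0 < V₂ := by rw [hV₂def]; linarith [latticeConst_nonneg (d + 1) (show 0 ≤ κ₁ / 2 by positivity)]
  obtain ⟨a₀, ha₀def⟩ : ∃ a₀ : ℝ, a₀ = min a₁ (γ₀ / (4 * ζ * V₁)) := ⟨_, rfl⟩
  have ha₀ : 0 < a₀ := ha₀def ▸ lt_min ha₁ (div_pos hγ₀ (by positivity))
  obtain ⟨γo, hγodef⟩ : ∃ γo : ℝ, γo = min (1 / 4) γP := ⟨_, rfl⟩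
  have hγo : 0 < γo := hγodef ▸ lt_min (by norm_num) hγP
  have hγo4 : γo ≤ 1 / 4 := hγodef ▸ min_le_left _ _
  have hγoP : γo ≤ γP := hγodef ▸ min_le_right _ _
  refine ⟨1, κ₁ / 2, a₀, 4 / γ₀ * (Cr + τ) * (4 / γ₀) * V₂ ^ 2, γo, one_pos, half_pos hκ₁, ha₀, by positivity, hγo, fun i _ α₀ hα₀ hMα U hreg => ?_⟩
  -- this index
  have hαa₀ : α₀ ≤ a₀ := (le_mul_of_one_le_left hα₀.le (hM i)).trans hMα
  have hαa₁ : α₀ ≤ a₁ := hαa₀.trans (ha₀def ▸ min_le_left _ _)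
  have hM1 : ∀ μ, 1 ≤ Mn i μ := fun μ => Nat.one_le_iff_ne_zero.mpr (NeZero.ne _)
  obtain ⟨hcoK, hcoK', hK, hK', hKK⟩ := HF (mT i) (kk i) (mm i) (hk i) (Mn i) (hMnT i)
  obtain ⟨hPc, hPf, hPfc⟩ := HP i α₀ hα₀ hαa₁ U hreg
  have hρ : ∀ p q : Idx (Mn i), 0 ≤ tdist (Mn i) p q := tdist_nonneg _
  have hρs : ∀ p q : Idx (Mn i), tdist (Mn i) p q = tdist (Mn i) q p := tdist_symm hM1
  have hρ0 : ∀ p : Idx (Mn i), tdist (Mn i) p p = 0 := tdist_self _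
  have hρt : ∀ p q r : Idx (Mn i), tdist (Mn i) p r ≤ tdist (Mn i) p q + tdist (Mn i) q r := tdist_triangle hM1
  have hV₁ : ∀ p : Idx (Mn i), ∑ q, Real.exp (-(κ / 4 * tdist (Mn i) p q)) ≤ V₁ := fun p =>
    (torusSum_le (d + 1) hM1 (by positivity) p).trans (by rw [hV₁def]; linarith)
  have hV₂ : ∀ p : Idx (Mn i), ∑ q, Real.exp (-(κ₁ / 2 * tdist (Mn i) p q)) ≤ V₂ := fun p =>
    (torusSum_le (d + 1) hM1 (by positivity) p).trans (by rw [hV₂def]; linarith)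
  have hLk1 : (1 : ℝ) ≤ (L : ℝ) ^ kk i := one_le_pow₀ hLR
  have hr4 : ((L : ℝ) ^ kk i) ^ (-(1 / 4 : ℝ)) ≤ ((L : ℝ) ^ kk i) ^ (-γo) := Real.rpow_le_rpow_of_exponent_le hLk1 (by linarith)
  have hrP : ((L : ℝ) ^ kk i) ^ (-γP) ≤ ((L : ℝ) ^ kk i) ^ (-γo) := Real.rpow_le_rpow_of_exponent_le hLk1 (by linarith)
  have hro : 0 ≤ ((L : ℝ) ^ kk i) ^ (-γo) := Real.rpow_nonneg (by positivity) _
  have hK₁ : ∀ p q, |qggqRe (L ^ kk i) (aK aS L (kk i)) (Mn i) p q| ≤ c₀ * Real.exp (-(κ * tdist (Mn i) p q)) :=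
    fun p q => (hK p q).trans (exp_decay_mono hc₀.le hκδ (hρ p q))
  have hK₁' : ∀ p q, |qggqRe (L ^ mm i * L ^ kk i) (aK aS L (kk i + mm i)) (Mn i) p q| ≤ c₀ * Real.exp (-(κ * tdist (Mn i) p q)) :=
    fun p q => (hK' p q).trans (exp_decay_mono hc₀.le hκδ (hρ p q))
  have hKK₁ : ∀ p q, |qggqRe (L ^ mm i * L ^ kk i) (aK aS L (kk i + mm i)) (Mn i) p q - qggqRe (L ^ kk i) (aK aS L (kk i)) (Mn i) p q|
      ≤ Cr * ((L : ℝ) ^ kk i) ^ (-γo) * Real.exp (-(κ * tdist (Mn i) p q)) := fun p q =>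
    (hKK p q).trans ((mul_le_mul_of_nonneg_right (mul_le_mul_of_nonneg_left hr4 hCr.le) (Real.exp_nonneg _)).trans
      (exp_decay_mono (mul_nonneg hCr.le hro) hκδ (hρ p q)))
  have hPc₁ : ∀ p q, |Pc i ((pair i).avg U) p q| ≤ ζ * α₀ * Real.exp (-(κ * tdist (Mn i) p q)) :=
    fun p q => (hPc p q).trans (exp_decay_mono (by positivity) hκP (hρ p q))
  have hPf₁ : ∀ p q, |Pf i U p q| ≤ ζ * α₀ * Real.exp (-(κ * tdist (Mn i) p q)) :=
    fun p q => (hPf p q).trans (exp_decay_mono (by positivity) hκP (hρ p q))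
  have hPP₁ : ∀ p q, |Pf i U p q - Pc i ((pair i).avg U) p q| ≤ τ * ((L : ℝ) ^ kk i) ^ (-γo) * Real.exp (-(κ * tdist (Mn i) p q)) := fun p q =>
    (hPfc p q).trans ((mul_le_mul_of_nonneg_right (mul_le_mul_of_nonneg_left hrP hτ.le) (Real.exp_nonneg _)).trans
      (exp_decay_mono (mul_nonneg hτ.le hro) hκP (hρ p q)))
  have hs₁ : ζ * α₀ * V₁ ≤ γ₀ / 2 := by
    have h1 : α₀ ≤ γ₀ / (4 * ζ * V₁) := hαa₀.trans (ha₀def ▸ min_le_right _ _)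
    have h2 := mul_le_mul_of_nonneg_left h1 (show 0 ≤ 4 * ζ * V₁ by positivity)
    rw [mul_div_cancel₀ _ (by positivity : (4 * ζ * V₁ : ℝ) ≠ 0)] at h2
    nlinarith
  have hs₂ : 8 * (c₀ + ζ * α₀) * V₁ * κ₁ ≤ γ₀ * κ := by
    have h1 : 8 * (c₀ + ζ * α₀) * V₁ * κ₁ ≤ 8 * (c₀ + ζ * a₁) * V₁ * κ₁ := by
      have := mul_le_mul_of_nonneg_left hαa₁ hζ.le
      have hVκ : 0 ≤ V₁ * κ₁ := by positivity
      nlinarith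
    exact h1.trans hκ₁s
  have h := abs_inv_add_sub_inv_add_le_of_coercive (tdist (Mn i)) hρ hρs hρ0 hρt hγ₀ hc₀.le (by positivity : 0 ≤ ζ * α₀)
    (by positivity : 0 ≤ Cr * ((L : ℝ) ^ kk i) ^ (-γo)) (by positivity : 0 ≤ τ * ((L : ℝ) ^ kk i) ^ (-γo)) hκ hκ₁.le hκ₁κ hcoK hcoK' hK₁ hK₁' hPc₁ hPf₁ hKK₁ hPP₁
    hV₁ hV₂ hs₁ hs₂
  -- the unit-site readout (G1) over the general carrier: `len ≡ 1`, rate factor `(L^k)^{−γo}`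
  have hLne : (L : ℝ) ≠ 0 := by exact_mod_cast (NeZero.ne L)
  have hLpos : (0 : ℝ) < (L : ℝ) := by exact_mod_cast hL0
  have hlen : ∀ y : (unitTorusGeoS L (kk i) (Mn i) (Msz i)).Site, (unitTorusGeoS L (kk i) (Mn i) (Msz i)).len y = 1 := fun y => by
    show (L : ℝ) ^ kk i * ((L : ℝ) ^ kk i)⁻¹ = 1
    exact mul_inv_cancel₀ (pow_ne_zero _ hLne)
  have hη : (unitTorusGeoS L (kk i) (Mn i) (Msz i)).eta ≠ 0 := inv_ne_zero (pow_ne_zero _ hLpos.ne')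
  refine etaRateIneqSite_opGeo_unit (g := unitTorusGeoS L (kk i) (Mn i) (Msz i)) (B := Bf i) (sSiteExOn Mn kk mm Msz X blk gf Bc Bf aS pair Pf Pc i)
    hlen hη hLpos (fun y y' => ?_) d' p
  have hyy := h (torIdx (Mn i) y) (torIdx (Mn i) y')
  rw [← tdistT_eq_tdist_torIdx] at hyy
  show |siteEx (L ^ mm i * L ^ kk i) (aK aS L (kk i + mm i)) (Mn i) (Pf i U) (torIdx (Mn i) y) (torIdx (Mn i) y')
        - siteEx (L ^ kk i) (aK aS L (kk i)) (Mn i) (Pc i ((pair i).avg U)) (torIdx (Mn i) y) (torIdx (Mn i) y')|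
      ≤ 4 / γ₀ * (Cr + τ) * (4 / γ₀) * V₂ ^ 2 * Real.exp (-(κ₁ / 2 * tdistT (Mn i) y y')) * max (((L : ℝ) ^ kk i) ^ (-γo)) (((L : ℝ) ^ kk i) ^ (-γo))
  rw [max_self]
  unfold siteEx
  refine hyy.trans (le_of_eq ?_)
  ring

/-! ## §3 The knit over the general carrier: operator and unit layers BY NAME + the site letters -/

/-- ★★ **`N15At` OVER THE GENERAL CARRIER FROM TWO LAYERS BY NAME AND THE SITE LETTERS**: an operator layer `NE2PlusOperator c₃₅ pi Kop` and a unit layer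
`NE2PlusUnit c₃₅ pi Kunit inΛ unitDist` on the same family (hypotheses — e.g. dag-n15-e Σ-b's `ne2PlusOperator_kingFullProp_background` with the rung's unit layer, or dag-n15-c's sized
families) + §2 ⟹ `N15At ⟨I, c₃₅, p, pi, Kop, sSiteExOn …, Kunit, inΛ, unitDist⟩`. [bookkeeping] -/
theorem n15At_s_of_layers (hLodd : Odd L) (hL2 : 2 ≤ L) {aS : ℝ} (haS : 0 < aS) {c35 : ℝ} (p : ℝ)
    {mT : I → ℕ} (hMnT : ∀ i μ, Mn i μ = 2 * L ^ mT i) (hk : ∀ i, 1 ≤ kk i) (hM : ∀ i, 1 ≤ (gf i).M)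
    (pair : ∀ i, EtaPairing (opGeo (unitTorusGeoS L (kk i) (Mn i) (Msz i)) (X i) (blk i)) (gf i) (Bc i) (Bf i))
    (Kop : ∀ i, B9.KernelFamily (opGeo (unitTorusGeoS L (kk i) (Mn i) (Msz i)) (X i) (blk i)) (Bf i))
    (hop : NE2PlusOperator c35 (fun i => (⟨opGeo (unitTorusGeoS L (kk i) (Mn i) (Msz i)) (X i) (blk i), gf i, Bc i, Bf i, pair i⟩ : PairedInstance)) Kop)
    (Kunit : ∀ i, B9.SiteKernel (opGeo (unitTorusGeoS L (kk i) (Mn i) (Msz i)) (X i) (blk i)) (Bf i)) (inΛ : ∀ i, Tor (Mn i) → Prop)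
    (unitDist : ∀ i, Tor (Mn i) → Tor (Mn i) → ℝ)
    (hunit : NE2PlusUnit c35 (fun i => (⟨opGeo (unitTorusGeoS L (kk i) (Mn i) (Msz i)) (X i) (blk i), gf i, Bc i, Bf i, pair i⟩ : PairedInstance)) Kunit inΛ unitDist)
    (Pf : ∀ i, (Bf i).Cfg → Matrix (Idx (Mn i)) (Idx (Mn i)) ℝ) (Pc : ∀ i, (Bc i).Cfg → Matrix (Idx (Mn i)) (Idx (Mn i)) ℝ) {γP : ℝ} (hγP : 0 < γP)
    (hP : ∃ δP ζ τ a₁ : ℝ, 0 < δP ∧ 0 < ζ ∧ 0 < τ ∧ 0 < a₁ ∧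
      ∀ (i : I) (α₀ : ℝ), 0 < α₀ → α₀ ≤ a₁ → ∀ U : (Bf i).Cfg, (Bf i).Reg335 c35 α₀ U →
        (∀ p q : Idx (Mn i), |Pc i ((pair i).avg U) p q| ≤ ζ * α₀ * Real.exp (-(δP * tdist (Mn i) p q))) ∧
        (∀ p q : Idx (Mn i), |Pf i U p q| ≤ ζ * α₀ * Real.exp (-(δP * tdist (Mn i) p q))) ∧
        (∀ p q : Idx (Mn i), |Pf i U p q - Pc i ((pair i).avg U) p q| ≤ τ * ((L : ℝ) ^ kk i) ^ (-γP) * Real.exp (-(δP * tdist (Mn i) p q)))) :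
    N15At { I := I, c35 := c35, p := p, pi := fun i => ⟨opGeo (unitTorusGeoS L (kk i) (Mn i) (Msz i)) (X i) (blk i), gf i, Bc i, Bf i, pair i⟩, Kop := Kop,
            Ksite := sSiteExOn Mn kk mm Msz X blk gf Bc Bf aS pair Pf Pc, Kunit := Kunit, inΛ := inΛ, unitDist := unitDist } :=
  ⟨hop, ne2PlusSite_sSiteExOn_of_letters Mn kk mm Msz X blk gf Bc Bf hLodd hL2 haS c35 4 p hMnT hk hM pair Pf Pc hγP hP, hunit⟩

end Summit.QuantumFields.YangMills.BalabanUVNodes.N15.SiteLayerBg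

end
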